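import Summits.Ventures.PercRepro.Night2T4RankFiveCore
import Summits.Ventures.PercRepro.Night2ThreeWindowCore
import Summits.Ventures.PercRepro.RankLevelSetPlaneSix

/-!
# PercRepro — THE COMPOSITION OF RECORD FOR `(7, 5)` (night-2, gen 4; RULING (so)(3))

C-025 at `(7, 5)` on every finite matroid from ONE named input on the core — `f(4) ≤ 10` (mine-4's proof from kernel
facts, typed by p2 as `card_le_ten_of_core`) — and night-4's trace sums (`SevenFiveTraceSumsCore`, the finite census of
corner (i)'s world):

* the type-`2` clause: night-4's `jq_two_nonneg_of_core_five` (the statement of record, RULING (sk));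
* the type-`3` clause: THEOREM R5″ (the coloop-free cut of R5′) with `f(5) ≤ 21` (`Jq_three_nonneg_five_of_core_of_ten`,
  `Night2ThreeWindowCore`);
* the type-`4` clause: the `13` dual certificates `(5, 0)` with `f(5) ≤ 21` (`Jq_four_nonneg_five_of_core_of_ten`,
  `Night2T4RankFiveCore`), the plane bound `≤ 6` discharged by night-1's `ncard_le_six_of_eRk_le_three_of_free`
  (the `e`-free clause of `Core`);

hence `sevenFiveLayersCoreFree_of_ten : (f(4) ≤ 10) → SevenFiveLayersCoreFree` and, through night-4's coloop bridge
`rls_seven_five_of_free`, **`rls_seven_five_of_core_of_ten : (f(4) ≤ 10 on every Core matroid) →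
SevenFiveTraceSumsCore → ∀ M, RLS M 7 5`**.  Imports `Night2T4RankFiveCore`, `Night2ThreeWindowCore` and
`RankLevelSetPlaneSix`.
-/
namespace PercRepro.Star

open Finset ThmH SixFour GenQ PerFlat ThmN NightThree

/-- **The three `(7, 5)` balances on the coloop-free rank-`5` flats of a rank-`7` Core matroid from `f(4) ≤ 10`.** -/
theorem sevenFiveLayersCoreFree_of_ten
    (h10 : ∀ {β : Type} [DecidableEq β] (M : Matroid β) [M.Finite] {p : ℕ}, Core M p →
      ∀ F ∈ flatsQ M 4, F.card ≤ 10) : SevenFiveLayersCoreFree := by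
  intro β _ M _ G hc hG hm
  have hplane : ∀ P ∈ flatsQ M 3, P.card ≤ 6 := by
    intro P hP
    have hP' := mem_flatsQ.1 hP
    have hPE : (P : Set β) ⊆ M.E := by
      rw [← coe_gr M]
      exact Finset.coe_subset.2 hP'.1
    have hr3 : M.eRk (P : Set β) ≤ 3 := by
      rw [hP'.2.2]
      rfl
    have h := ncard_le_six_of_eRk_le_three_of_free M hc.2.2.2 hPE hr3
    rwa [Set.ncard_coe_finset] at h
  refine ⟨fun hcard => jq_two_nonneg_of_core_five hc hG hcard, ?_, ?_⟩
  · exact Jq_three_nonneg_five_of_core_of_ten hc (h10 M hc) hG hm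
  · exact Jq_four_nonneg_five_of_core_of_ten hc hplane (h10 M hc) hG hm

/-- **THE COMPOSITION OF RECORD: C-025 at `(7, 5)` on every finite matroid** from `f(4) ≤ 10` on the core and the trace
sums of corner (i) (night-4's finite census on rank-`4` sets). -/
theorem rls_seven_five_of_core_of_ten {γ : Type} [DecidableEq γ]
    (h10 : ∀ {β : Type} [DecidableEq β] (M : Matroid β) [M.Finite] {p : ℕ}, Core M p →
      ∀ F ∈ flatsQ M 4, F.card ≤ 10)
    (htr : SevenFiveTraceSumsCore) (M : Matroid γ) [M.Finite] : RLS M 7 5 :=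
  rls_seven_five_of_free htr (sevenFiveLayersCoreFree_of_ten h10) M

end PercRepro.Star
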